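import Literature.NumberTheory.IwasawaTheory.EquivariantUnramifiedHomsZpTowerFinite
import Literature.NumberTheory.EllipticCurves.FineSelmerClassGroupPRankBoundedProofs
import HarnessLib

/-!
# Coates–Sujatha's Conjecture A from BOUNDED ISOTYPIC MULTIPLICITIES: statement (A) for `E` at an odd `p`
# over the cyclotomic `ℤ_p`-extension from a bound on the `Gal(·/K_n)`-EQUIVARIANT additive maps
# `Cl(K(E[p])·K_n) → E[p]` along the tower (the `λ`-tolerant isotypic criterion; proved)

`Proofs`-style file (theorems only: no definition, no named fact, no `sorry`) in topic
`NumberTheory/EllipticCurves`, namespace `Literature.NumberTheory.EllipticCurves.CoatesSujatha2005`,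
written by the literature seat `bsd-potss-conjA-anchor` g19 (cell `bsd-potss`; serves the asides
stmt-BirchSwinnertonDyer-19386 / 19413; closes nothing; BSD / (A) is proved for no particular curve here).

THE THEOREM (`fineSelmerDual_moduleFinite_of_card_equivariantHom_le`).  `K` a number field, `E = W/K`
elliptic, `p` odd, `κ` the cyclotomic `ℤ_p`-extension of `K`, `L = K(E[p])`, `L_n = L·K_n = K̄^{Γ_L ∩ κ⁻¹(pⁿℤ_p)}`.
IF there is `C` such that for every `n` the additive maps `μ : Cl(𝓞_{L_n}) → E[p]` that are equivariant
under `Gal(K̄/K_n)` (`μ(γ|_{L_n} · c) = γ • μ(c)`, i.e. `Gal(L_n/K_n)`-equivariant — the `E[p]`-ISOTYPIC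
part of `Cl(L_n) ⊗ 𝔽_p` counted through `Hom_{Gal(L_n/K_n)}(Cl(L_n), E[p])`) number at most `C`, THEN
statement (A) holds for `E` at `p`: the Pontryagin dual of `Sel₀(K_∞, E[p^∞])` is finitely generated over
`ℤ_p` (`∃ γ D, Module.Finite ℤ_[p] D.X`, the tree's spelling).  Companion over the compositum spelling
`W.divisionField p ⊔ κ.layer n` of the layers: `…_of_card_equivariantHom_divisionField_layer_le`.

This is the `λ`-TOLERANT ISOTYPIC form of Coates–Sujatha 2005 Thm. 3.4 / Lemma 3.8 in the reading of Lim
(*Notes on the fine Selmer groups*, §3: «`Hom_G(X_nr(L_∞)/p, ρ̄)` is finite iff the `ρ̄`-isotypic `μ`-invariant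
vanishes»): the VANISHING criteria of the tree (door L6 `conjA_of_not_dvd_card_classGroup`, door L5
`conjA_of_homTrivial_layer'`, Deo–Ray–Sujatha's (c2)) ask `Hom_G(Cl(L_n), E[p]) = 0` at one layer; the
BOUNDED-`p`-RANK road (`fineSelmerDual_moduleFinite_of_forall_classGroupPRank_le`, seat k8t-c4 g21) asks the
FULL `p`-rank of `Cl(L_n)` to stay bounded (classical `μ = 0` of `L`); here only the `E[p]`-isotypic count must
stay bounded — no hypothesis on the image of `ρ̄`, none at the primes above `p`, none at the bad primes.

Proof: (A) ⟺ `Sel₀(K_∞, E[p])` finite (Lim–Sujatha, tree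
`LimSujatha2018.fineSelmerDual_moduleFinite_iff_finite_fineSelmerInfty_torsion`) ⟸ the `Gal(K̄/K_∞)`-EQUIVARIANT
everywhere-unramified continuous homomorphisms `Gal(K̄/L·K_∞) → E[p]` are finite (§1–§2: the restriction of
a fine Selmer cocycle to the trivialising subgroup is such a homomorphism, `φ(huh⁻¹) = h • φ(u)`, and a
cocycle is determined by this restriction and finitely many values) ⟸ the equivariant class-group counts are
bounded (`IwasawaTheory.EquivariantUnramifiedHomsZpTowerFinite.equivariantUnramifiedHoms_finite_of_card_le`:
descent to a finite layer + equivariant class field theory).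

References: [CoatesSujatha2005] §3 Lemma 3.8, Thm. 3.4 (Math. Ann. 331 (2005) 809–839);
[LimSujatha2018] §3 (J. Number Theory 187 (2018)); [Lim2017FineSelmer] §3 (the isotypic reading);
[KuriharaPollack2007] §3.1; [SilvermanAEC2009] X.§4 Lemma 4.3 (proof).
-/

set_option autoImplicit false

noncomputable section

open scoped Classical Pointwise NumberField
open NumberField IsDedekindDomain Field IntermediateField

/-! ## §1 Fine Selmer cocycles restrict to `Gal(K̄/K_∞)`-EQUIVARIANT unramified homomorphisms -/

namespace Literature.NumberTheory.EllipticCurves.FineSelmerTrivialisingRestriction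

open Literature.NumberTheory.EllipticCurves Literature.NumberTheory.EllipticCurves.GreenbergSelmer
  Literature.NumberTheory.GaloisRepresentations

section Equivariant

variable {K : Type} [Field K] [NumberField K]
variable {M : Type} [AddCommGroup M] [DistribMulAction (absoluteGaloisGroup K) M]
  [TopologicalSpace M] [DiscreteTopology M]
variable {p : ℕ} [Fact p.Prime] (κ : ZpExtension K p)

omit [NumberField K] in
/-- **The restriction of a cocycle on `H = Gal(K̄/K_∞)` to `U_∞ = N ⊓ H` (`N` the kernel of the action on
`M`) is `H`-equivariant under conjugation**: `φ(h u h⁻¹) = h • φ(u)` for `h ∈ H`, `u ∈ U_∞` — the cocycle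
identity, `u` acting trivially on `M` and `φ(h) + h • φ(h⁻¹) = φ(1) = 0`.  (The restriction
`H¹(K_∞, M) → H¹(L·K_∞, M) = Hom(Gal(K̄/L·K_∞), M)` lands in the `Gal(L·K_∞/K_∞)`-invariants.)
[cite: SerreGaloisCohomology1997, I.§5.8 (inflation–restriction: the image of restriction is `G/H`-invariant)]
[cite: CoatesSujatha2005, §3 Lemma 3.8 (`R(E/L_∞) ≅ Hom_G(Y_∞/p, E[p])`)] -/
theorem restrict_equivariant_of_cocycle
    (φ : contOneCocycles (discreteTopRep κ.kerSubgroup M))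
    (h : absoluteGaloisGroup K) (hh : h ∈ κ.kerSubgroup)
    (u u' : ↥(fixingSubgroupOfModule K M ⊓ κ.kerSubgroup))
    (hu' : (u' : absoluteGaloisGroup K) = h * u * h⁻¹) :
    φ.1 ⟨(u' : absoluteGaloisGroup K), (Subgroup.mem_inf.1 u'.2).2⟩ =
      h • φ.1 ⟨(u : absoluteGaloisGroup K), (Subgroup.mem_inf.1 u.2).2⟩ := by
  have hcoc := (mem_contOneCocycles_iff φ.1).1 φ.2
  set hH : κ.kerSubgroup := ⟨h, hh⟩ with hhHdef
  set uH : κ.kerSubgroup := ⟨(u : absoluteGaloisGroup K), (Subgroup.mem_inf.1 u.2).2⟩ with huHdef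
  have hu'eq : (⟨(u' : absoluteGaloisGroup K), (Subgroup.mem_inf.1 u'.2).2⟩ : κ.kerSubgroup) =
      hH * uH * hH⁻¹ := Subtype.ext (by simp only [Subgroup.coe_mul, Subgroup.coe_inv, hhHdef, huHdef]; exact hu')
  rw [hu'eq]
  -- `φ 1 = 0` and `φ(h) + h • φ(h⁻¹) = 0`
  have h1 : φ.1 1 = 0 := contOneCocycles.apply_one φ
  have hinv : φ.1 hH + (hH : absoluteGaloisGroup K) • φ.1 hH⁻¹ = 0 := by
    have h := hcoc hH hH⁻¹
    rw [mul_inv_cancel, h1, discreteTopRep_ρ_apply, Subgroup.smul_def] at h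
    exact h.symm
  -- the cocycle identity on `h u h⁻¹`
  have huM : (uH : absoluteGaloisGroup K) • φ.1 hH⁻¹ = φ.1 hH⁻¹ :=
    smul_eq_of_mem_fixingSubgroupOfModule (Subgroup.mem_inf.1 u.2).1 _
  rw [hcoc, hcoc, discreteTopRep_ρ_apply, discreteTopRep_ρ_apply, Subgroup.smul_def, Subgroup.smul_def,
    Subgroup.coe_mul, mul_smul, huM]
  change φ.1 hH + h • φ.1 uH + h • φ.1 hH⁻¹ = h • φ.1 uH
  have hinv' : φ.1 hH + h • φ.1 hH⁻¹ = 0 := hinv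
  rw [add_assoc, add_comm (h • φ.1 uH), ← add_assoc, hinv', zero_add]

/-- **`Sel₀(K_∞, M)` is finite if the `H`-EQUIVARIANT members of `Hom(Gal(K̄/K(M)·K_∞), M; ∅)` are
finite.**  Refinement of `finite_fineSelmerInfty_of_finite_unramifiedHoms`: the cocycles with class in
`Sel₀(K_∞, M)` inject into `{f ∈ unramifiedHoms (N ⊓ H) M ∅ | f equivariant under H} × M^{H/(N ⊓ H)}`.
[cite: CoatesSujatha2005, §3 Lemma 3.8 and Thm. 3.4 (proof)] [cite: SilvermanAEC2009, Lemma X.4.3 (proof, step 1)] -/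
theorem finite_fineSelmerInfty_of_finite_equivariantUnramifiedHoms [Finite M]
    [ContinuousSMul (absoluteGaloisGroup K) M]
    (hfin : {f ∈ unramifiedHoms (fixingSubgroupOfModule K M ⊓ κ.kerSubgroup) M
        (∅ : Set (HeightOneSpectrum (𝓞 K))) |
      ∀ h ∈ κ.kerSubgroup, ∀ u u' : ↥(fixingSubgroupOfModule K M ⊓ κ.kerSubgroup),
        (u' : absoluteGaloisGroup K) = h * u * h⁻¹ → f u' = h • f u}.Finite) :
    (fineSelmerInfty M κ : Set (subgroupH1 κ.kerSubgroup M)).Finite := by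
  set N := fixingSubgroupOfModule K M with hNdef
  set H := κ.kerSubgroup with hHdef
  set V : Subgroup H := (N ⊓ H).subgroupOf H with hVdef
  -- `V` is open in the compact group `H`, so `H/V` is finite
  have hNopen : IsOpen (N : Set (absoluteGaloisGroup K)) := isOpen_fixingSubgroupOfModule
  haveI : CompactSpace H := isCompact_iff_compactSpace.mp κ.isClosed_kerSubgroup.isCompact
  have hVopen : IsOpen (V : Set H) := by
    have : (V : Set H) = Subtype.val ⁻¹' (N : Set (absoluteGaloisGroup K)) := by
      ext x
      simp only [hVdef, SetLike.mem_coe, Subgroup.mem_subgroupOf, Subgroup.mem_inf, Set.mem_preimage]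
      exact ⟨fun h ↦ h.1, fun h ↦ ⟨h, x.2⟩⟩
    rw [this]
    exact hNopen.preimage continuous_subtype_val
  haveI : Finite (H ⧸ V) := Subgroup.quotient_finite_of_isOpen V hVopen
  -- the cocycles with class in `Sel₀` form a finite set
  have hZ : {φ : contOneCocycles (discreteTopRep κ.kerSubgroup M) |
      oneCocycleClass _ φ ∈ fineSelmerInfty M κ}.Finite := by
    have hprod : ({f ∈ unramifiedHoms (N ⊓ H) M (∅ : Set (HeightOneSpectrum (𝓞 K))) |
        ∀ h ∈ κ.kerSubgroup, ∀ u u' : ↥(N ⊓ H),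
          (u' : absoluteGaloisGroup K) = h * u * h⁻¹ → f u' = h • f u} ×ˢ
        (Set.univ : Set (H ⧸ V → M))).Finite := hfin.prod Set.finite_univ
    refine Set.Finite.of_finite_image (hprod.subset ?_) (restrict_prod_injective κ).injOn
    rintro _ ⟨φ, hφ, rfl⟩
    exact ⟨⟨restrict_mem_unramifiedHoms_of_mem_fineSelmerInfty κ φ hφ,
      fun h hh u u' hu' => restrict_equivariant_of_cocycle κ φ h hh u u' hu'⟩, Set.mem_univ _⟩
  have hsub : (fineSelmerInfty M κ : Set (subgroupH1 κ.kerSubgroup M)) ⊆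
      oneCocycleClass (discreteTopRep κ.kerSubgroup M) ''
        {φ | oneCocycleClass _ φ ∈ fineSelmerInfty M κ} := by
    intro x hx
    obtain ⟨φ, rfl⟩ := oneCocycleClass_surjective _ x
    exact ⟨φ, hx, rfl⟩
  exact (hZ.image _).subset hsub

end Equivariant

end Literature.NumberTheory.EllipticCurves.FineSelmerTrivialisingRestriction

/-! ## §2 Statement (A) from bounded equivariant class-group counts along `K(E[p])·K_n` -/

namespace Literature.NumberTheory.EllipticCurves.CoatesSujatha2005

open WeierstrassCurve Literature.NumberTheory.IwasawaTheory Literature.NumberTheory.GaloisRepresentations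
  Literature.NumberTheory.NumberFields Literature.NumberTheory.EllipticCurves
  Literature.NumberTheory.EllipticCurves.GreenbergSelmer Literature.NumberTheory.EllipticCurves.ZpExtension
  Literature.NumberTheory.IwasawaTheory.EquivariantUnramifiedHomsZpTowerFinite

variable {K : Type} [Field K] [NumberField K] (W : WeierstrassCurve K) [W.IsElliptic] {p : ℕ} [Fact p.Prime]

/-- **Coates–Sujatha's Conjecture A from bounded ISOTYPIC multiplicities (PROVED).**  `E = W` elliptic over a
number field `K`, `p` odd, `κ` the cyclotomic `ℤ_p`-extension of `K`, `N = Gal(K̄/K(E[p]))` the kernel of the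
mod-`p` representation, `L_n = K̄^{N ∩ κ⁻¹(pⁿℤ_p)} = K(E[p])·K_n`.  If for every `n` the additive maps
`μ : Cl(𝓞_{L_n}) → E[p]` which are equivariant under `Gal(K̄/K_n)` (`μ(γ|_{L_n} · c) = γ • μ(c)`; i.e. the
`Gal(L_n/K_n)`-equivariant ones — the `E[p]`-isotypic count of `Cl(L_n) ⊗ 𝔽_p`) number at most `C`, then the
dual fine Selmer group of `E` over `K_∞` is finitely generated over `ℤ_p` (statement (A)).
[cite: CoatesSujatha2005, §3 Lemma 3.8 and Thm. 3.4] [cite: Lim2017FineSelmer, §3 (isotypic reading of Thm. 3.4)]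
[cite: LimSujatha2018, §3 (lemma before Prop. 3.2)] -/
theorem fineSelmerDual_moduleFinite_of_card_equivariantHom_le (hp : p ≠ 2) (κ : ZpExtension K p)
    (hκ : κ.IsCyclotomic) (C : ℕ)
    (hC : ∀ n : ℕ,
      haveI := W.fixingSubgroupOfModule_geomTorsion_normal p
      haveI : IsGalois K (fixedField (fixingSubgroupOfModule K ↥(W.geomTorsion (p : ℤ)) ⊓ κ.layerSubgroup n) :
          IntermediateField K (AlgebraicClosure K)) :=
        isGalois_fixedField_inf_layerSubgroup κ (fixingSubgroupOfModule K ↥(W.geomTorsion (p : ℤ)))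
          (W.isOpen_fixingSubgroupOfModule_geomTorsion p) n
      Nat.card {μ : Additive (ClassGroup (𝓞 (fixedField
          (fixingSubgroupOfModule K ↥(W.geomTorsion (p : ℤ)) ⊓ κ.layerSubgroup n) :
            IntermediateField K (AlgebraicClosure K)))) →+ W.geomTorsion (p : ℤ) //
        ∀ γ ∈ κ.layerSubgroup n, ∀ c,
          μ (Additive.ofMul (ClassGroup.mulEquiv (AmbiguousClass.intAut
            (absRestrictNormalHom (fixedField
              (fixingSubgroupOfModule K ↥(W.geomTorsion (p : ℤ)) ⊓ κ.layerSubgroup n) :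
                IntermediateField K (AlgebraicClosure K)) γ)) c)) = γ • μ (Additive.ofMul c)} ≤ C) :
    ∃ (γ : absoluteGaloisGroup K) (D : W.FineSelmerDualData κ γ),
      Module.Finite ℤ_[p] (RestrictScalars ℤ_[p] (IwasawaAlgebra p) D.X) := by
  have hpr : p.Prime := Fact.out
  haveI : NeZero p := ⟨hpr.ne_zero⟩
  haveI : Finite ↥(W.geomTorsion (p : ℤ)) := W.finite_geomTorsion_nat hpr.ne_zero
  haveI : ContinuousSMul (absoluteGaloisGroup K) ↥(W.geomTorsion (p : ℤ)) :=
    WeierstrassCurve.continuousSMul_geomTorsion W (WeierstrassCurve.isOpen_stabilizer_point_holds W) (p : ℤ)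
  haveI : (fixingSubgroupOfModule K ↥(W.geomTorsion (p : ℤ))).Normal := W.fixingSubgroupOfModule_geomTorsion_normal p
  have hN : IsOpen (fixingSubgroupOfModule K ↥(W.geomTorsion (p : ℤ)) : Set (absoluteGaloisGroup K)) :=
    W.isOpen_fixingSubgroupOfModule_geomTorsion p
  have hpM : ∀ m : ↥(W.geomTorsion (p : ℤ)), p • m = 0 := fun m =>
    Subtype.ext (by
      rw [AddSubmonoidClass.coe_nsmul, ZeroMemClass.coe_zero]
      exact AddSubgroup.torsionBy.nsmul_iff.mp m.2)
  have hNM : ∀ σ ∈ fixingSubgroupOfModule K ↥(W.geomTorsion (p : ℤ)), ∀ x : ↥(W.geomTorsion (p : ℤ)),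
      σ • x = x := fun σ hσ x => smul_eq_of_mem_fixingSubgroupOfModule hσ x
  rw [LimSujatha2018.fineSelmerDual_moduleFinite_iff_finite_fineSelmerInfty_torsion W hp κ hκ]
  exact FineSelmerTrivialisingRestriction.finite_fineSelmerInfty_of_finite_equivariantUnramifiedHoms κ
    (equivariantUnramifiedHoms_finite_of_card_le κ _ hN hp _ hNM hpM C hC)

/-- **The same criterion over the compositum spelling `K(E[p]) ⊔ K_n` of the layers** (`W.divisionField p ⊔
κ.layer n = K̄^{N ∩ κ⁻¹(pⁿℤ_p)}`, tree `fixedField_inf_layerSubgroup_eq`): if for every `n` the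
`Gal(K̄/K_n)`-equivariant additive maps `Cl(𝓞_{K(E[p])K_n}) → E[p]` number at most `C`, statement (A) holds
for `E` at `p`.  This is the shape the record lanes instantiate (`K = ℚ`: `Gal(L_n/ℚ_n) ≅ Gal(ℚ(E[p])/ℚ)`
when `p ∤ #Gal(ℚ(E[p])/ℚ)`).
[cite: CoatesSujatha2005, §3 Lemma 3.8 and Thm. 3.4] [cite: Lim2017FineSelmer, §3 (isotypic reading of Thm. 3.4)] -/
theorem fineSelmerDual_moduleFinite_of_card_equivariantHom_divisionField_layer_le (hp : p ≠ 2)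
    (κ : ZpExtension K p) (hκ : κ.IsCyclotomic) (C : ℕ)
    (hC : ∀ n : ℕ,
      haveI : NeZero p := ⟨(Fact.out : p.Prime).ne_zero⟩
      haveI := κ.isGalois_layer_holds n
      Nat.card {μ : Additive (ClassGroup (𝓞 ↥(W.divisionField p ⊔ κ.layer n))) →+ W.geomTorsion (p : ℤ) //
        ∀ γ ∈ κ.layerSubgroup n, ∀ c,
          μ (Additive.ofMul (ClassGroup.mulEquiv (AmbiguousClass.intAut
            (absRestrictNormalHom (W.divisionField p ⊔ κ.layer n) γ)) c)) = γ • μ (Additive.ofMul c)} ≤ C) :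
    ∃ (γ : absoluteGaloisGroup K) (D : W.FineSelmerDualData κ γ),
      Module.Finite ℤ_[p] (RestrictScalars ℤ_[p] (IwasawaAlgebra p) D.X) := by
  have hpr : p.Prime := Fact.out
  haveI : NeZero p := ⟨hpr.ne_zero⟩
  refine fineSelmerDual_moduleFinite_of_card_equivariantHom_le W hp κ hκ C fun n => ?_
  -- transport the count along `K̄^{N ∩ κ⁻¹(pⁿℤ_p)} = K(E[p]) ⊔ K_n` (instances are proofs of `Prop`s)
  have key : ∀ (E₂ : IntermediateField K (AlgebraicClosure K))
      (hE : (fixedField (fixingSubgroupOfModule K ↥(W.geomTorsion (p : ℤ)) ⊓ κ.layerSubgroup n) :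
        IntermediateField K (AlgebraicClosure K)) = E₂) [IsGalois K E₂],
      Nat.card {μ : Additive (ClassGroup (𝓞 ↥E₂)) →+ W.geomTorsion (p : ℤ) //
        ∀ γ ∈ κ.layerSubgroup n, ∀ c,
          μ (Additive.ofMul (ClassGroup.mulEquiv (AmbiguousClass.intAut
            (absRestrictNormalHom E₂ γ)) c)) = γ • μ (Additive.ofMul c)} ≤ C →
      haveI := W.fixingSubgroupOfModule_geomTorsion_normal p
      haveI : IsGalois K (fixedField (fixingSubgroupOfModule K ↥(W.geomTorsion (p : ℤ)) ⊓ κ.layerSubgroup n) :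
          IntermediateField K (AlgebraicClosure K)) :=
        isGalois_fixedField_inf_layerSubgroup κ (fixingSubgroupOfModule K ↥(W.geomTorsion (p : ℤ)))
          (W.isOpen_fixingSubgroupOfModule_geomTorsion p) n
      Nat.card {μ : Additive (ClassGroup (𝓞 (fixedField
          (fixingSubgroupOfModule K ↥(W.geomTorsion (p : ℤ)) ⊓ κ.layerSubgroup n) :
            IntermediateField K (AlgebraicClosure K)))) →+ W.geomTorsion (p : ℤ) //
        ∀ γ ∈ κ.layerSubgroup n, ∀ c,
          μ (Additive.ofMul (ClassGroup.mulEquiv (AmbiguousClass.intAut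
            (absRestrictNormalHom (fixedField
              (fixingSubgroupOfModule K ↥(W.geomTorsion (p : ℤ)) ⊓ κ.layerSubgroup n) :
                IntermediateField K (AlgebraicClosure K)) γ)) c)) = γ • μ (Additive.ofMul c)} ≤ C := by
    intro E₂ hE _ h
    subst hE
    exact h
  haveI := κ.isGalois_layer_holds n
  exact key (W.divisionField p ⊔ κ.layer n) (fixedField_inf_layerSubgroup_eq W κ n) (hC n)

end Literature.NumberTheory.EllipticCurves.CoatesSujatha2005

end
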